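import Literature.NumberTheory.IwasawaTheory.ClassicalMuVanishesSplitCartanFiveDescentAbelianSteps
import HarnessLib

set_option autoImplicit false

/-!
# Ferrero–Washington-FREE `μ`-descent for Galois groups of split-Cartan-normaliser type `N_s(5) = (C₄ × C₄) ⋊ C₂` (e.g. `ℚ(E[5])`)

Topic `NumberTheory/IwasawaTheory` (namespace = path).  THEOREM-ONLY file (no definition, no named fact, no `sorry`); prover seat
`bsd-potss-k8t-c4` g24 (cell `bsd-potss`; supports stmt-BirchSwinnertonDyer-19982 / 19916 on the `5Ns` rows; closes nothing).
Twin of `classicalMuVanishes_of_isCyclotomic_of_splitCartan_kuroda_rat` (conjA-anchor g11) with its ONLY named fact,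
`ferreroWashington1979_classicalMuVanishes`, REMOVED: for `u, v, w ∈ G = Gal(L/ℚ)` with the relations of `N_s(5)`, «`μ = 0` for every
cyclotomic `ℤ_p`-extension of `L`» follows from the same for the SIX leaves `L^{⟨v⟩}` (`ℚ(P₁)`), `L^{⟨u²v⟩}`, `L^{⟨uv, w⟩}` (`ℚ(C)`),
`K′ = L^{⟨uv⁻¹, w⟩}` (cyclic quartic `⊇ ℚ(√5)`), `Z = L^{⟨uv⁻¹, u²w⟩}` (`= ℚ(ζ₅)` for `L = ℚ(E[5])`), `Q₂ = L^{⟨uv⁻¹, wu⟩}` (quadratic) — the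
last three are exactly the abelian fields Ferrero–Washington supplied in g11's road (they carry the five linear characters of `N_s(5)`
invisible in the first three leaves; `L^{⟨u²,v⟩} ⊆ L^{⟨v⟩}` is redundant).  Steps (3′), (4′), (5′) = g11's (3), (4), (5) with the
Ferrero–Washington leaves replaced by `A = L^{⟨uv⁻¹⟩}` and `B = L^{⟨uv⁻¹, u²⟩}` (`ClassicalMuVanishesSplitCartanFiveDescentAbelianSteps`);
steps (1), (2) are g11's verbatim.  Kuroda EQUALITIES at every layer; no growth theorem.
References: [Lemmermeyer1994, §1]; [Washington1997, §7.5, §13.1]; [MilneFT2022, Ch. 3]; [Serre1972, §2.2 (Cartan subgroups)].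
-/
noncomputable section

open scoped NumberField

open Field IntermediateField Literature.NumberTheory.EllipticCurves

namespace Literature.NumberTheory.IwasawaTheory

variable {p : ℕ} [Fact p.Prime]

omit [Fact p.Prime] in
/-- A central element generates a normal subgroup. [folklore] -/
private theorem normal_zpowers_of_forall_comm {G : Type} [Group G] {z : G} (hzc : ∀ g : G, g * z = z * g) :
    (Subgroup.zpowers z).Normal := by
  refine ⟨fun h hh a => ?_⟩
  obtain ⟨k, rfl⟩ := Subgroup.mem_zpowers_iff.mp hh
  have hc : Commute a z := hzc a
  rw [(hc.zpow_right k).eq, mul_inv_cancel_right]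
  exact hh

set_option maxHeartbeats 800000 in
/-- **Step (4′), FW-free: `L^{V₀}`, `V₀ = ⟨u², v²⟩ ⊴ G`, `G/V₀ ≅ D₄`** from `L^{⟨u², v⟩}` (`ℚ(x P₁)`, conjugated by `w` to `L^{⟨v², u⟩}`) and the
biquadratic leaf `B = L^{⟨uv⁻¹, u²⟩} ⊇ L^{V₀⟨uv⟩}`: Kuroda step `…_of_kuroda_conj` for `Gal(L^{V₀}/ℚ)` with `z̄ = \overline{uv}` (leaf `B`), `b̄ = ū`,
conjugator `w̄` (g11's step (4) had the `z̄`-leaf from Ferrero–Washington). [cite: Lemmermeyer1994, §1] [cite: Washington1997, §13.1] [cite: MilneFT2022, Ch. 3] -/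
theorem classicalMuVanishes_of_isCyclotomic_fixedField_sq_sup_sq' (hp2 : p ≠ 2)
    (L : Type) [Field L] [NumberField L] [IsGalois ℚ L] (hp : ¬ p ∣ Module.finrank ℚ L)
    {u v w : L ≃ₐ[ℚ] L} (huv : u * v = v * u) (hwu : w * u * w⁻¹ = v) (hwv : w * v * w⁻¹ = u)
    (hsc : ∀ g : L ≃ₐ[ℚ] L, g * (u * v) = (u * v) * g)
    (hVu : ∀ g : L ≃ₐ[ℚ] L, g * (u * u) * g⁻¹ = u * u ∨ g * (u * u) * g⁻¹ = v * v)
    (hVv : ∀ g : L ≃ₐ[ℚ] L, g * (v * v) * g⁻¹ = u * u ∨ g * (v * v) * g⁻¹ = v * v)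
    (hμX : ∀ κE : ZpExtension ↥(fixedField (Subgroup.zpowers (u * u) ⊔ Subgroup.zpowers v)) p,
      κE.IsCyclotomic → ClassicalMuVanishes κE)
    (hμB : ∀ κE : ZpExtension ↥(fixedField (Subgroup.zpowers (u * v⁻¹) ⊔ Subgroup.zpowers (u * u))) p,
      κE.IsCyclotomic → ClassicalMuVanishes κE) :
    ∀ κE : ZpExtension ↥(fixedField (Subgroup.zpowers (u * u) ⊔ Subgroup.zpowers (v * v))) p,
      κE.IsCyclotomic → ClassicalMuVanishes κE := by
  have hc : Commute u v := huv
  obtain ⟨V₀, hV₀⟩ : ∃ V₀ : Subgroup (L ≃ₐ[ℚ] L), V₀ = Subgroup.zpowers (u * u) ⊔ Subgroup.zpowers (v * v) := ⟨_, rfl⟩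
  have huuV : u * u ∈ V₀ := hV₀ ▸ Subgroup.mem_sup_left (Subgroup.mem_zpowers _)
  have hvvV : v * v ∈ V₀ := hV₀ ▸ Subgroup.mem_sup_right (Subgroup.mem_zpowers _)
  haveI hVN : V₀.Normal := by
    refine ⟨fun n hn g => ?_⟩
    have hle : V₀.map (MulAut.conj g).toMonoidHom ≤ V₀ := by
      rw [hV₀, Subgroup.map_sup, MonoidHom.map_zpowers, MonoidHom.map_zpowers, ← hV₀]
      refine sup_le (Subgroup.zpowers_le.mpr ?_) (Subgroup.zpowers_le.mpr ?_)
      · rw [MulEquiv.coe_toMonoidHom, MulAut.conj_apply]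
        rcases hVu g with h | h
        · rw [h]; exact huuV
        · rw [h]; exact hvvV
      · rw [MulEquiv.coe_toMonoidHom, MulAut.conj_apply]
        rcases hVv g with h | h
        · rw [h]; exact huuV
        · rw [h]; exact hvvV
    have h1 : (MulAut.conj g).toMonoidHom n ∈ V₀.map (MulAut.conj g).toMonoidHom := Subgroup.mem_map_of_mem _ hn
    have h2 := hle h1
    rwa [MulEquiv.coe_toMonoidHom, MulAut.conj_apply] at h2
  rw [← hV₀]
  haveI : IsGalois ℚ ↥(fixedField V₀) := IsGalois.of_fixedField_normal_subgroup V₀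
  have hp₀ : ¬ p ∣ Module.finrank ℚ ↥(fixedField V₀) := not_dvd_finrank_intermediateField_rat hp _
  obtain ⟨π, hπ⟩ : ∃ π : (L ≃ₐ[ℚ] L) →* (↥(fixedField V₀) ≃ₐ[ℚ] ↥(fixedField V₀)),
      π = AlgEquiv.restrictNormalHom ↥(fixedField V₀) := ⟨_, rfl⟩
  have hπsurj : Function.Surjective π := hπ ▸ AlgEquiv.restrictNormalHom_surjective L
  have hker : ∀ g, π g = 1 ↔ g ∈ V₀ := by
    intro g
    have h1 := IntermediateField.restrictNormalHom_ker (K := ℚ) (L := L) (fixedField V₀)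
    rw [IntermediateField.fixingSubgroup_fixedField] at h1
    rw [← MonoidHom.mem_ker, hπ]
    exact SetLike.ext_iff.mp h1 g
  have hI3 : (u * v) * (u * v) = u * u * (v * v) := by
    calc (u * v) * (u * v) = u * (v * u) * v := by group
      _ = u * (u * v) * v := by rw [← huv]
      _ = u * u * (v * v) := by group
  have hz : π (u * v) * π (u * v) = 1 := by
    rw [← map_mul, hker, hI3]
    exact V₀.mul_mem huuV hvvV
  have hb : π u * π u = 1 := by rw [← map_mul, hker]; exact huuV
  have hzb : π (u * v) * π u = π u * π (u * v) := by rw [← map_mul, ← map_mul, hsc u]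
  have hconj : ∃ g, g * π u * g⁻¹ = π (u * v) * π u := by
    refine ⟨π w, ?_⟩
    have h1 : π ((u * v * u)⁻¹ * v) = 1 := by
      rw [hker]
      have h2 : (u * v * u)⁻¹ * v = (u * u)⁻¹ := by
        calc (u * v * u)⁻¹ * v = u⁻¹ * (v⁻¹ * u⁻¹) * v := by group
          _ = u⁻¹ * (u⁻¹ * v⁻¹) * v := by rw [← hc.inv_inv.eq]
          _ = (u * u)⁻¹ := by group
      rw [h2]
      exact V₀.inv_mem huuV
    rw [map_mul, map_inv, inv_mul_eq_one] at h1
    rw [← map_mul, ← map_inv, ← map_mul, hwu, ← map_mul, h1]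
  -- the `μ`-input for `L₀^{⟨b̄⟩} ≅ L^{V₀ ⊔ ⟨u⟩} = L^{⟨v²⟩ ⊔ ⟨u⟩} ≅ L^{⟨u²⟩ ⊔ ⟨v⟩}` (conjugation by `w`)
  have hwuu : w * (u * u) * w⁻¹ = v * v := by
    calc w * (u * u) * w⁻¹ = (w * u * w⁻¹) * (w * u * w⁻¹) := by group
      _ = v * v := by rw [hwu]
  have hmapw : (Subgroup.zpowers (u * u) ⊔ Subgroup.zpowers v).map (MulAut.conj w).toMonoidHom =
      Subgroup.zpowers (v * v) ⊔ Subgroup.zpowers u := by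
    rw [Subgroup.map_sup, MonoidHom.map_zpowers, MonoidHom.map_zpowers, MulEquiv.coe_toMonoidHom, MulAut.conj_apply,
      MulAut.conj_apply, hwuu, hwv]
  have heq : Subgroup.zpowers (v * v) ⊔ Subgroup.zpowers u = V₀ ⊔ Subgroup.zpowers u := by
    refine le_antisymm (sup_le (Subgroup.zpowers_le.mpr (Subgroup.mem_sup_left hvvV)) le_sup_right)
      (sup_le ?_ le_sup_right)
    rw [hV₀]
    exact sup_le (Subgroup.zpowers_le.mpr (Subgroup.mem_sup_right
      ((Subgroup.zpowers u).mul_mem (Subgroup.mem_zpowers u) (Subgroup.mem_zpowers u))))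
      (Subgroup.zpowers_le.mpr (Subgroup.mem_sup_left (Subgroup.mem_zpowers _)))
  have hV₀π : V₀.map π = ⊥ := by
    rw [Subgroup.map_eq_bot_iff]
    intro g hg
    rw [MonoidHom.mem_ker]
    exact (hker g).mpr hg
  have hmapπ : (V₀ ⊔ Subgroup.zpowers u).map π = Subgroup.zpowers (π u) := by
    rw [Subgroup.map_sup, MonoidHom.map_zpowers, hV₀π, bot_sup_eq]
  have hμb : ∀ κE : ZpExtension ↥(fixedField (Subgroup.zpowers (π u))) p, κE.IsCyclotomic → ClassicalMuVanishes κE :=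
    forall_classicalMuVanishes_fixedField_quotient hp V₀ (V₀ ⊔ Subgroup.zpowers u) le_sup_left π hπ _ hmapπ
      (forall_classicalMuVanishes_fixedField_of_eq hp heq (forall_classicalMuVanishes_fixedField_of_conj hp _ _ w hmapw hμX))
  -- the `μ`-input for `L₀^{⟨z̄⟩} ≅ L^{V₀ ⊔ ⟨uv⟩} ⊆ B = L^{⟨uv⁻¹, u²⟩}` (`u v⁻¹ = (uv)(v²)⁻¹`)
  have hleB : Subgroup.zpowers (u * v⁻¹) ⊔ Subgroup.zpowers (u * u) ≤ V₀ ⊔ Subgroup.zpowers (u * v) := by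
    refine sup_le (Subgroup.zpowers_le.mpr ?_) (Subgroup.zpowers_le.mpr (Subgroup.mem_sup_left huuV))
    rw [show u * v⁻¹ = (u * v) * (v * v)⁻¹ by group]
    exact (V₀ ⊔ _).mul_mem (Subgroup.mem_sup_right (Subgroup.mem_zpowers _)) ((V₀ ⊔ _).inv_mem (Subgroup.mem_sup_left hvvV))
  have hmapz : (V₀ ⊔ Subgroup.zpowers (u * v)).map π = Subgroup.zpowers (π (u * v)) := by
    rw [Subgroup.map_sup, MonoidHom.map_zpowers, hV₀π, bot_sup_eq]
  have hμz : ∀ κE : ZpExtension ↥(fixedField (Subgroup.zpowers (π (u * v)))) p, κE.IsCyclotomic → ClassicalMuVanishes κE :=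
    forall_classicalMuVanishes_fixedField_quotient hp V₀ (V₀ ⊔ Subgroup.zpowers (u * v)) le_sup_left π hπ _ hmapz
      (forall_classicalMuVanishes_fixedField_of_le hp hleB hμB)
  exact classicalMuVanishes_of_isCyclotomic_of_kuroda_conj hp2 ↥(fixedField V₀) hp₀ hz hb hzb hconj hμz hμb

set_option maxHeartbeats 800000 in
/-- **Step (5′), FW-free: `L₂ = L^{⟨uv⟩}` (`uv` central), `G/⟨uv⟩ ≅ D₄`** from `L^{⟨uv⟩ ⊔ ⟨w⟩}` (`ℚ(C)`) and the biquadratic leaf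
`B = L^{⟨uv⁻¹, u²⟩} ⊇ L^{⟨uv⟩⟨u²⟩}`: Kuroda step `…_of_kuroda_conj` with `z̄ = ū²` (leaf `B`), `b̄ = w̄`, conjugator `ū` (g11's step (5) had the
`z̄`-leaf from Ferrero–Washington). [cite: Lemmermeyer1994, §1 (Kuroda's class number formula, odd part)] [cite: Washington1997, §13.1, §7.5]
[cite: MilneFT2022, Ch. 3] -/
theorem classicalMuVanishes_of_isCyclotomic_fixedField_zpowers_mul' (hp2 : p ≠ 2)
    (L : Type) [Field L] [NumberField L] [IsGalois ℚ L] (hp : ¬ p ∣ Module.finrank ℚ L)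
    {u v w : L ≃ₐ[ℚ] L} (huv : u * v = v * u) (hu4 : u * u * (u * u) = 1) (hw2 : w * w = 1)
    (hwu : w * u * w⁻¹ = v) (hwv : w * v * w⁻¹ = u) (hsc : ∀ g : L ≃ₐ[ℚ] L, g * (u * v) = (u * v) * g)
    (hμC : ∀ κE : ZpExtension ↥(fixedField (Subgroup.zpowers (u * v) ⊔ Subgroup.zpowers w)) p,
      κE.IsCyclotomic → ClassicalMuVanishes κE)
    (hμB : ∀ κE : ZpExtension ↥(fixedField (Subgroup.zpowers (u * v⁻¹) ⊔ Subgroup.zpowers (u * u))) p,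
      κE.IsCyclotomic → ClassicalMuVanishes κE) :
    ∀ κE : ZpExtension ↥(fixedField (Subgroup.zpowers (u * v))) p, κE.IsCyclotomic → ClassicalMuVanishes κE := by
  obtain ⟨C, hC⟩ : ∃ C : Subgroup (L ≃ₐ[ℚ] L), C = Subgroup.zpowers (u * v) := ⟨_, rfl⟩
  haveI hCN : C.Normal := hC ▸ normal_zpowers_of_forall_comm hsc
  rw [← hC]
  haveI : IsGalois ℚ ↥(fixedField C) := IsGalois.of_fixedField_normal_subgroup C
  have hp₀ : ¬ p ∣ Module.finrank ℚ ↥(fixedField C) := not_dvd_finrank_intermediateField_rat hp _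
  obtain ⟨π, hπ⟩ : ∃ π : (L ≃ₐ[ℚ] L) →* (↥(fixedField C) ≃ₐ[ℚ] ↥(fixedField C)),
      π = AlgEquiv.restrictNormalHom ↥(fixedField C) := ⟨_, rfl⟩
  have hπsurj : Function.Surjective π := hπ ▸ AlgEquiv.restrictNormalHom_surjective L
  have hker : ∀ g, π g = 1 ↔ g ∈ C := by
    intro g
    have h1 := IntermediateField.restrictNormalHom_ker (K := ℚ) (L := L) (fixedField C)
    rw [IntermediateField.fixingSubgroup_fixedField] at h1
    rw [← MonoidHom.mem_ker, hπ]
    exact SetLike.ext_iff.mp h1 g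
  have huvC : u * v ∈ C := hC ▸ Subgroup.mem_zpowers _
  have hπuv : π (u * v) = 1 := (hker _).mpr huvC
  have hI3 : (u * v) * (u * v) = u * u * (v * v) := by
    calc (u * v) * (u * v) = u * (v * u) * v := by group
      _ = u * (u * v) * v := by rw [← huv]
      _ = u * u * (v * v) := by group
  have hwuu : w * (u * u) * w⁻¹ = v * v := by
    calc w * (u * u) * w⁻¹ = (w * u * w⁻¹) * (w * u * w⁻¹) := by group
      _ = v * v := by rw [hwu]
  have hwinv : w⁻¹ = w := inv_eq_of_mul_eq_one_right hw2
  have hwuu' : w * (u * u) * w = v * v := by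
    have h := hwuu
    rwa [hwinv] at h
  have ha : u * u * w = w * (v * v) := by
    calc u * u * w = (w * w) * (u * u) * w := by rw [hw2, one_mul]
      _ = w * (w * (u * u) * w) := by group
      _ = w * (v * v) := by rw [hwuu']
  have hb' : v * v = (u * u)⁻¹ * ((u * v) * (u * v)) := by rw [hI3]; group
  have hwvinv : w * v⁻¹ = u⁻¹ * w := by
    calc w * v⁻¹ = (w * v * w⁻¹)⁻¹ * w := by group
      _ = u⁻¹ * w := by rw [hwv]
  have hcid : u * w * u⁻¹ = u * u * w * (u * v)⁻¹ := by
    calc u * w * u⁻¹ = u * u * (u⁻¹ * w) * u⁻¹ := by group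
      _ = u * u * (w * v⁻¹) * u⁻¹ := by rw [← hwvinv]
      _ = u * u * w * (u * v)⁻¹ := by group
  have hd : u * v⁻¹ = u * u * (u * v)⁻¹ := by
    calc u * v⁻¹ = u * u * (v * u)⁻¹ := by group
      _ = u * u * (u * v)⁻¹ := by rw [← huv]
  have hz : π (u * u) * π (u * u) = 1 := by rw [← map_mul, hu4, map_one]
  have hzinv : (π (u * u))⁻¹ = π (u * u) := inv_eq_of_mul_eq_one_right hz
  have hπvv : π (v * v) = π (u * u) := by
    rw [hb', map_mul, map_inv, map_mul π (u * v) (u * v), hπuv, mul_one, mul_one, hzinv]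
  have hb : π w * π w = 1 := by rw [← map_mul, hw2, map_one]
  have hzb : π (u * u) * π w = π w * π (u * u) := by
    rw [← map_mul, ha, map_mul, hπvv]
  have hconj : ∃ g, g * π w * g⁻¹ = π (u * u) * π w := by
    refine ⟨π u, ?_⟩
    rw [← map_inv, ← map_mul, ← map_mul, hcid, map_mul, map_inv, hπuv, inv_one, mul_one, map_mul]
  -- `μ`-input for `L₂^{⟨w̄⟩} ≅ L^{C ⊔ ⟨w⟩}`
  have hCπ : C.map π = ⊥ := by
    rw [Subgroup.map_eq_bot_iff]
    intro g hg
    rw [MonoidHom.mem_ker]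
    exact (hker g).mpr hg
  have hmapπ : (C ⊔ Subgroup.zpowers w).map π = Subgroup.zpowers (π w) := by
    rw [Subgroup.map_sup, MonoidHom.map_zpowers, hCπ, bot_sup_eq]
  have hμb : ∀ κE : ZpExtension ↥(fixedField (Subgroup.zpowers (π w))) p, κE.IsCyclotomic → ClassicalMuVanishes κE :=
    forall_classicalMuVanishes_fixedField_quotient hp C (C ⊔ Subgroup.zpowers w) le_sup_left π hπ _ hmapπ (by rw [hC]; exact hμC)
  -- `μ`-input for `L₂^{⟨z̄⟩} ≅ L^{C ⊔ ⟨u²⟩} ⊆ B = L^{⟨uv⁻¹, u²⟩}` (`u v⁻¹ = u²(uv)⁻¹`)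
  have hleB : Subgroup.zpowers (u * v⁻¹) ⊔ Subgroup.zpowers (u * u) ≤ C ⊔ Subgroup.zpowers (u * u) := by
    refine sup_le (Subgroup.zpowers_le.mpr ?_) le_sup_right
    rw [hd]
    exact (C ⊔ _).mul_mem (Subgroup.mem_sup_right (Subgroup.mem_zpowers _)) ((C ⊔ _).inv_mem (Subgroup.mem_sup_left huvC))
  have hmapz : (C ⊔ Subgroup.zpowers (u * u)).map π = Subgroup.zpowers (π (u * u)) := by
    rw [Subgroup.map_sup, MonoidHom.map_zpowers, hCπ, bot_sup_eq]
  have hμz : ∀ κE : ZpExtension ↥(fixedField (Subgroup.zpowers (π (u * u)))) p, κE.IsCyclotomic → ClassicalMuVanishes κE :=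
    forall_classicalMuVanishes_fixedField_quotient hp C (C ⊔ Subgroup.zpowers (u * u)) le_sup_left π hπ _ hmapz
      (forall_classicalMuVanishes_fixedField_of_le hp hleB hμB)
  exact classicalMuVanishes_of_isCyclotomic_of_kuroda_conj hp2 ↥(fixedField C) hp₀ hz hb hzb hconj hμz hμb

set_option maxHeartbeats 800000 in
/-- **Step (3′), FW-free: `M = L^{⟨v²u²⟩}` and the CENTRAL Klein four `{1, v̄², \overline{uv}, v̄² \overline{uv}}` of `Gal(M/ℚ)`.**  Supports:
`L^{⟨u², v²⟩}` (4′), `L^{⟨uv⟩}` (5′) and — replacing Ferrero–Washington — the maximal abelian leaf `A = L^{⟨uv⁻¹⟩}` (`u v⁻¹ = v²·uv`). [cite: Lemmermeyer1994, §1 (Kuroda's class number formula, odd part)] [cite: Washington1997, §13.1, §7.5]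
[cite: MilneFT2022, Ch. 3] -/
theorem classicalMuVanishes_of_isCyclotomic_fixedField_zpowers_sq_mul_sq' (hp2 : p ≠ 2)
    (L : Type) [Field L] [NumberField L] [IsGalois ℚ L] (hp : ¬ p ∣ Module.finrank ℚ L)
    {u v : L ≃ₐ[ℚ] L} (huv : u * v = v * u) (hv4 : v * v * (v * v) = 1)
    (hsc : ∀ g : L ≃ₐ[ℚ] L, g * (u * v) = (u * v) * g)
    (hμA : ∀ κE : ZpExtension ↥(fixedField (Subgroup.zpowers (u * v⁻¹))) p, κE.IsCyclotomic → ClassicalMuVanishes κE)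
    (hμV : ∀ κE : ZpExtension ↥(fixedField (Subgroup.zpowers (u * u) ⊔ Subgroup.zpowers (v * v))) p,
      κE.IsCyclotomic → ClassicalMuVanishes κE)
    (hμ₂ : ∀ κE : ZpExtension ↥(fixedField (Subgroup.zpowers (u * v))) p, κE.IsCyclotomic → ClassicalMuVanishes κE) :
    ∀ κE : ZpExtension ↥(fixedField (Subgroup.zpowers (v * v * (u * u)))) p, κE.IsCyclotomic → ClassicalMuVanishes κE := by
  have hc : Commute u v := huv
  -- identities in `G`
  have hI3 : (u * v) * (u * v) = u * u * (v * v) := by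
    calc (u * v) * (u * v) = u * (v * u) * v := by group
      _ = u * (u * v) * v := by rw [← huv]
      _ = u * u * (v * v) := by group
  have hI3b : v * v * (u * u) = u * u * (v * v) :=
    ((hc.symm.mul_right hc.symm).mul_left (hc.symm.mul_right hc.symm)).eq
  have hI5 : v * v * (u * u) = (u * v) * (u * v) := hI3b.trans hI3.symm
  have hvinv : v⁻¹ = v * v * v := inv_eq_of_mul_eq_one_right (by rw [← hv4]; group)
  have hcvv : u * (v * v) = v * v * u := (hc.mul_right hc).eq
  have hI4 : u * v⁻¹ = v * v * (u * v) := by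
    calc u * v⁻¹ = (u * (v * v)) * v := by rw [hvinv]; group
      _ = (v * v * u) * v := by rw [hcvv]
      _ = v * v * (u * v) := by group
  obtain ⟨Z, hZ⟩ : ∃ Z : Subgroup (L ≃ₐ[ℚ] L), Z = Subgroup.zpowers (v * v * (u * u)) := ⟨_, rfl⟩
  have hzcc : ∀ g : L ≃ₐ[ℚ] L, g * (v * v * (u * u)) = v * v * (u * u) * g := by
    intro g
    rw [hI5]
    calc g * ((u * v) * (u * v)) = (g * (u * v)) * (u * v) := by group
      _ = ((u * v) * g) * (u * v) := by rw [hsc g]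
      _ = (u * v) * (g * (u * v)) := by group
      _ = (u * v) * ((u * v) * g) := by rw [hsc g]
      _ = (u * v) * (u * v) * g := by group
  haveI hZN : Z.Normal := hZ ▸ normal_zpowers_of_forall_comm hzcc
  rw [← hZ]
  haveI : IsGalois ℚ ↥(fixedField Z) := IsGalois.of_fixedField_normal_subgroup Z
  have hp₀ : ¬ p ∣ Module.finrank ℚ ↥(fixedField Z) := not_dvd_finrank_intermediateField_rat hp _
  obtain ⟨π, hπ⟩ : ∃ π : (L ≃ₐ[ℚ] L) →* (↥(fixedField Z) ≃ₐ[ℚ] ↥(fixedField Z)),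
      π = AlgEquiv.restrictNormalHom ↥(fixedField Z) := ⟨_, rfl⟩
  have hπsurj : Function.Surjective π := hπ ▸ AlgEquiv.restrictNormalHom_surjective L
  have hker : ∀ g, π g = 1 ↔ g ∈ Z := by
    intro g
    have h1 := IntermediateField.restrictNormalHom_ker (K := ℚ) (L := L) (fixedField Z)
    rw [IntermediateField.fixingSubgroup_fixedField] at h1
    rw [← MonoidHom.mem_ker, hπ]
    exact SetLike.ext_iff.mp h1 g
  have hzcZ : v * v * (u * u) ∈ Z := hZ ▸ Subgroup.mem_zpowers _
  have hπzc : π (v * v * (u * u)) = 1 := (hker _).mpr hzcZ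
  have hZπ : Z.map π = ⊥ := by
    rw [Subgroup.map_eq_bot_iff]
    intro g hg
    rw [MonoidHom.mem_ker]
    exact (hker g).mpr hg
  have hz : π (v * v) * π (v * v) = 1 := by rw [← map_mul, hv4, map_one]
  have hb : π (u * v) * π (u * v) = 1 := by rw [← map_mul, ← hI5, hπzc]
  have hzb : π (v * v) * π (u * v) = π (u * v) * π (v * v) := by rw [← map_mul, ← map_mul, hsc (v * v)]
  -- (a) `M^{z̄} ≅ L^{Z ⊔ ⟨v²⟩} = L^{⟨u²⟩ ⊔ ⟨v²⟩}`
  have heqa : Subgroup.zpowers (u * u) ⊔ Subgroup.zpowers (v * v) = Z ⊔ Subgroup.zpowers (v * v) := by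
    refine le_antisymm (sup_le (Subgroup.zpowers_le.mpr ?_) le_sup_right) (sup_le ?_ le_sup_right)
    · have h1 : u * u = (v * v)⁻¹ * (v * v * (u * u)) := by group
      rw [h1]
      exact (Z ⊔ _).mul_mem ((Z ⊔ _).inv_mem (Subgroup.mem_sup_right (Subgroup.mem_zpowers _)))
        (Subgroup.mem_sup_left hzcZ)
    · rw [hZ, Subgroup.zpowers_le]
      exact (_ ⊔ _ : Subgroup (L ≃ₐ[ℚ] L)).mul_mem (Subgroup.mem_sup_right (Subgroup.mem_zpowers _))
        (Subgroup.mem_sup_left (Subgroup.mem_zpowers _))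
  have hmapa : (Z ⊔ Subgroup.zpowers (v * v)).map π = Subgroup.zpowers (π (v * v)) := by
    rw [Subgroup.map_sup, MonoidHom.map_zpowers, hZπ, bot_sup_eq]
  have hμa : ∀ κE : ZpExtension ↥(fixedField (Subgroup.zpowers (π (v * v)))) p,
      κE.IsCyclotomic → ClassicalMuVanishes κE :=
    forall_classicalMuVanishes_fixedField_quotient hp Z _ le_sup_left π hπ _ hmapa (forall_classicalMuVanishes_fixedField_of_eq hp heqa hμV)
  -- (b) `M^{b̄} ≅ L^{Z ⊔ ⟨uv⟩} = L^{⟨uv⟩}`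
  have heqb : Subgroup.zpowers (u * v) = Z ⊔ Subgroup.zpowers (u * v) := by
    refine le_antisymm le_sup_right (sup_le ?_ le_rfl)
    rw [hZ, Subgroup.zpowers_le, hI5]
    exact (Subgroup.zpowers _).mul_mem (Subgroup.mem_zpowers _) (Subgroup.mem_zpowers _)
  have hmapb : (Z ⊔ Subgroup.zpowers (u * v)).map π = Subgroup.zpowers (π (u * v)) := by
    rw [Subgroup.map_sup, MonoidHom.map_zpowers, hZπ, bot_sup_eq]
  have hμb : ∀ κE : ZpExtension ↥(fixedField (Subgroup.zpowers (π (u * v)))) p,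
      κE.IsCyclotomic → ClassicalMuVanishes κE :=
    forall_classicalMuVanishes_fixedField_quotient hp Z _ le_sup_left π hπ _ hmapb (forall_classicalMuVanishes_fixedField_of_eq hp heqb hμ₂)
  -- (c) `M^{z̄ b̄} ≅ L^{Z ⊔ ⟨v²·uv⟩} ⊆ A = L^{⟨uv⁻¹⟩}` since `u v⁻¹ = v²·uv`
  obtain ⟨Sc, hSc⟩ : ∃ Sc : Subgroup (L ≃ₐ[ℚ] L), Sc = Z ⊔ Subgroup.zpowers (v * v * (u * v)) := ⟨_, rfl⟩
  have hlec : Subgroup.zpowers (u * v⁻¹) ≤ Sc :=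
    Subgroup.zpowers_le.mpr (by rw [hI4, hSc]; exact Subgroup.mem_sup_right (Subgroup.mem_zpowers _))
  have hmapc : Sc.map π = Subgroup.zpowers (π (v * v) * π (u * v)) := by
    rw [hSc, Subgroup.map_sup, MonoidHom.map_zpowers, hZπ, bot_sup_eq, map_mul π (v * v) (u * v)]
  have hμc : ∀ κE : ZpExtension ↥(fixedField (Subgroup.zpowers (π (v * v) * π (u * v)))) p,
      κE.IsCyclotomic → ClassicalMuVanishes κE :=
    forall_classicalMuVanishes_fixedField_quotient hp Z Sc (hSc ▸ le_sup_left) π hπ _ hmapc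
      (forall_classicalMuVanishes_fixedField_of_le hp hlec hμA)
  -- (d) `M^{⟨z̄, b̄⟩} ≅ L^{Z ⊔ (⟨v²⟩ ⊔ ⟨uv⟩)} ⊆ A`
  obtain ⟨Sd, hSd⟩ : ∃ Sd : Subgroup (L ≃ₐ[ℚ] L), Sd = Z ⊔ (Subgroup.zpowers (v * v) ⊔ Subgroup.zpowers (u * v)) :=
    ⟨_, rfl⟩
  have hled : Subgroup.zpowers (u * v⁻¹) ≤ Sd :=
    Subgroup.zpowers_le.mpr (by
      rw [hI4, hSd]
      exact Subgroup.mem_sup_right ((_ ⊔ _ : Subgroup (L ≃ₐ[ℚ] L)).mul_mem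
        (Subgroup.mem_sup_left (Subgroup.mem_zpowers _)) (Subgroup.mem_sup_right (Subgroup.mem_zpowers _))))
  have hmapd : Sd.map π = Subgroup.closure {π (v * v), π (u * v)} := by
    rw [hSd, Subgroup.map_sup, Subgroup.map_sup, MonoidHom.map_zpowers, MonoidHom.map_zpowers, hZπ, bot_sup_eq,
      Set.insert_eq, Subgroup.closure_union, ← Subgroup.zpowers_eq_closure, ← Subgroup.zpowers_eq_closure]
  have hμd : ∀ κE : ZpExtension ↥(fixedField (Subgroup.closure {π (v * v), π (u * v)})) p,
      κE.IsCyclotomic → ClassicalMuVanishes κE :=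
    forall_classicalMuVanishes_fixedField_quotient hp Z Sd (hSd ▸ le_sup_left) π hπ _ hmapd
      (forall_classicalMuVanishes_fixedField_of_le hp hled hμA)
  exact classicalMuVanishes_of_isCyclotomic_of_biquadratic hp2 ↥(fixedField Z) hp₀ hz hb hzb hμa hμb hμc hμd

/-- **`N_s(5)` census form, Ferrero–Washington-FREE: `μ(L) = 0 ⟸ μ = 0` for `L^{⟨v⟩}`, `L^{⟨u²v⟩}`, `L^{⟨uv, w⟩}`, `K′ = L^{⟨uv⁻¹, w⟩}`,
`Z = L^{⟨uv⁻¹, u²w⟩}`, `Q₂ = L^{⟨uv⁻¹, wu⟩}` — NO named fact.**  `L/ℚ` finite Galois, `p` odd, `p ∤ [L : ℚ]`; `u, v, w ∈ Gal(L/ℚ)` with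
`uv = vu`, `u⁴ = v⁴ = 1`, `w² = 1`, `w u w⁻¹ = v`, `w v w⁻¹ = u`, `uv` central, `⟨u², v²⟩` normal (as the displayed alternatives),
`[G,G] ≤ ⟨u v⁻¹⟩`.  For `L = ℚ(E[5])` with `Gal ≅ N_s(5)`: `u = diag(2,1)`, `v = diag(1,2)`, `w = (0 1; 1 0)`; `L^{⟨v⟩} = ℚ(P₁)` (8),
`L^{⟨u²v⟩}` (8), `L^{⟨uv,w⟩} = ℚ(C)` (`C = ⟨P₁ + P₂⟩`, 4), `K′` = the cyclic quartic subfield of `A = L^{[G,G]} = ℚ(ζ₅, √d₁)` other than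
`ℚ(ζ₅)` (`d₁ = disc L^{C_s(5)}`), `Z = L^{ker det} = ℚ(ζ₅)`, `Q₂ = ℚ(√(5d₁))`.  Twin of
`classicalMuVanishes_of_isCyclotomic_of_splitCartan_kuroda_rat` (g11) WITHOUT `ferreroWashington1979_classicalMuVanishes` and without the
redundant leaf `L^{⟨u²,v⟩} ⊆ L^{⟨v⟩}`. [cite: Lemmermeyer1994, §1 (Kuroda's class number formula, odd part)] [cite: Washington1997, §13.1, §7.5]
[cite: MilneFT2022, Ch. 3 (fundamental theorem of Galois theory)] [cite: Serre1972, §2.2 (split Cartan subgroups and normalisers)] -/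
theorem classicalMuVanishes_of_isCyclotomic_of_splitCartan_kuroda_rat_abelian
    (hp2 : p ≠ 2) (L : Type) [Field L] [NumberField L] [IsGalois ℚ L] (hp : ¬ p ∣ Module.finrank ℚ L)
    {u v w : L ≃ₐ[ℚ] L} (huv : u * v = v * u) (hu4 : u * u * (u * u) = 1) (hv4 : v * v * (v * v) = 1) (hw2 : w * w = 1)
    (hwu : w * u * w⁻¹ = v) (hwv : w * v * w⁻¹ = u) (hsc : ∀ g : L ≃ₐ[ℚ] L, g * (u * v) = (u * v) * g)
    (hVu : ∀ g : L ≃ₐ[ℚ] L, g * (u * u) * g⁻¹ = u * u ∨ g * (u * u) * g⁻¹ = v * v)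
    (hVv : ∀ g : L ≃ₐ[ℚ] L, g * (v * v) * g⁻¹ = u * u ∨ g * (v * v) * g⁻¹ = v * v)
    (hcomm : ∀ a c : L ≃ₐ[ℚ] L, a * c * a⁻¹ * c⁻¹ ∈ Subgroup.zpowers (u * v⁻¹))
    (hμP : ∀ κE : ZpExtension ↥(fixedField (Subgroup.zpowers v)) p, κE.IsCyclotomic → ClassicalMuVanishes κE)
    (hμD : ∀ κE : ZpExtension ↥(fixedField (Subgroup.zpowers (u * u * v))) p, κE.IsCyclotomic → ClassicalMuVanishes κE)
    (hμC : ∀ κE : ZpExtension ↥(fixedField (Subgroup.zpowers (u * v) ⊔ Subgroup.zpowers w)) p,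
      κE.IsCyclotomic → ClassicalMuVanishes κE)
    (hμK : ∀ κE : ZpExtension ↥(fixedField (Subgroup.zpowers (u * v⁻¹) ⊔ Subgroup.zpowers w)) p,
      κE.IsCyclotomic → ClassicalMuVanishes κE)
    (hμZ : ∀ κE : ZpExtension ↥(fixedField (Subgroup.zpowers (u * v⁻¹) ⊔ Subgroup.zpowers (u * u * w))) p,
      κE.IsCyclotomic → ClassicalMuVanishes κE)
    (hμQ : ∀ κE : ZpExtension ↥(fixedField (Subgroup.zpowers (u * v⁻¹) ⊔ Subgroup.zpowers (w * u))) p,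
      κE.IsCyclotomic → ClassicalMuVanishes κE)
    (κL : ZpExtension L p) (hκL : κL.IsCyclotomic) : ClassicalMuVanishes κL := by
  have hc : Commute u v := huv
  have hμX : ∀ κE : ZpExtension ↥(fixedField (Subgroup.zpowers (u * u) ⊔ Subgroup.zpowers v)) p,
      κE.IsCyclotomic → ClassicalMuVanishes κE :=
    forall_classicalMuVanishes_fixedField_of_le hp le_sup_right hμP
  have hμB := classicalMuVanishes_of_isCyclotomic_fixedField_comm_sup_sq hp2 L hp hw2 hcomm hμP hμK hμQ
  have hμA := classicalMuVanishes_of_isCyclotomic_fixedField_comm hp2 L hp hu4 hw2 hcomm hμB hμK hμZ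
  have hμV := classicalMuVanishes_of_isCyclotomic_fixedField_sq_sup_sq' hp2 L hp huv hwu hwv hsc hVu hVv hμX hμB
  have hμ₂ := classicalMuVanishes_of_isCyclotomic_fixedField_zpowers_mul' hp2 L hp huv hu4 hw2 hwu hwv hsc hμC hμB
  have hμM := classicalMuVanishes_of_isCyclotomic_fixedField_zpowers_sq_mul_sq' hp2 L hp huv hv4 hsc hμA hμV hμ₂
  have hμZ2 := classicalMuVanishes_of_isCyclotomic_fixedField_zpowers_sq hp2 L hp huv hu4 hμV hμP hμD hμX
  -- step (1): the Klein four `{1, v², u², v²u²}` of `G`, `u² = w v² w⁻¹`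
  have hz : v * v * (v * v) = 1 := hv4
  have hb : u * u * (u * u) = 1 := hu4
  have hzb : v * v * (u * u) = u * u * (v * v) := ((hc.symm.mul_right hc.symm).mul_left (hc.symm.mul_right hc.symm)).eq
  have hwvv : w * (v * v) * w⁻¹ = u * u := by
    rw [show w * (v * v) * w⁻¹ = (w * v * w⁻¹) * (w * v * w⁻¹) by group, hwv]
  have hmapw : (Subgroup.zpowers (v * v)).map (MulAut.conj w).toMonoidHom = Subgroup.zpowers (u * u) := by
    rw [MonoidHom.map_zpowers, MulEquiv.coe_toMonoidHom, MulAut.conj_apply, hwvv]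
  have hμU := forall_classicalMuVanishes_fixedField_of_conj hp _ _ w hmapw hμZ2
  have heqC : Subgroup.zpowers (u * u) ⊔ Subgroup.zpowers (v * v) = Subgroup.closure {v * v, u * u} := by
    rw [Set.insert_eq, Subgroup.closure_union, ← Subgroup.zpowers_eq_closure, ← Subgroup.zpowers_eq_closure, sup_comm]
  exact classicalMuVanishes_of_isCyclotomic_of_biquadratic hp2 L hp hz hb hzb hμZ2 hμU hμM
    (forall_classicalMuVanishes_fixedField_of_eq hp heqC hμV) κL hκL

end Literature.NumberTheory.IwasawaTheory

end
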